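import Mathlib
import Summits.CriticalPhenomena.CardyFormulaZ2.Theorems.CardyMagicRigidityDefs
import Summits.CriticalPhenomena.CardyFormulaZ2.Theorems.CardyMagicRigidityPositiveConeDefs
import Summits.CriticalPhenomena.CardyFormulaZ2.Theorems.CardyMagicRigidityNestingRigidityTiltUniqueness
import Summits.CriticalPhenomena.CardyFormulaZ2.Theorems.CardyMagicRigidityNestingRigidityFusionBaseCases
import Summits.CriticalPhenomena.CardyFormulaZ2.Theorems.CardyMagicRigidityNestingRigidityTowerCountMeasurable
import Summits.CriticalPhenomena.CardyFormulaZ2.Theorems.CardyMagicRigidityNestingRigidityPgfUniqueness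
import HarnessLib

/-!
# Stub S5 · `Fusion`: reduction to tilt agreement, one-disc layer, statement audit

Crux `Summit.CriticalPhenomena.CardyFormulaZ2.Theses.CardyMagicRigidity.NestingRigidity`
(stmt-CriticalPhenomena-4835), line `ring-cloud-tomography` (r3), registered stub `stub_fusion : Fusion`,
`Fusion := zEns.CloudLaw → tEns.CloudLaw → TowerStatisticsAgree → NestingStatisticsAgree`
(`Theorems/CardyMagicRigidityDefs.lean`). The layers `n ≥ 2` are the crux content; this helper file
records, sorry-free, what IS formal about S5, in the shared vocabulary of the sibling line
`positive-cone-weight-doubling` (`TiltAgreementAt`, `LawAgreementAt`, `PGFUniqueness`, `cyl`, `tilt`):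

* §1 `fusion_of_tiltAgreement` (registered sub-goal) — PURE-LOGIC GLUE: positive tilt agreement at
  every admissible disc configuration and `PGFUniqueness` give `Fusion`; the cylinder probability
  `cyl` of `LawAgreementAt` is literally the probability compared in `NestingStatisticsAgree`, and the
  cloud-law / `TowerStatisticsAgree` antecedents of `Fusion` are not used; with the sibling seat's
  landed `stub_pgfUniqueness` the `PGFUniqueness` hypothesis is discharged (`fusion_of_tiltAgreement'`).
* §2 one disc: `patternCount c ![z₀] ![r₀] R {0}` is the number of loops of the window `B(0, R)`
  surrounding `B̄(z₀, r₀)` (`patternCount_one_eq`, the avoidance clause is vacuous) and is SANDWICHED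
  between the `z₀`-centred tower counts with windows `B(z₀, R ∓ ‖z₀‖)` (`towerCount_le_patternCount_one`,
  `patternCount_one_le_towerCount`; on both lattices at positive mesh: `towerCount_le_patternCount_one_le`,
  finiteness from `ncard_loops_meeting_le` / `ncard_loops_siteLoopConfig_meeting_le`).
* §3 `nestingStatisticsAgree_one_of_oneDiscTilt` — the whole `n = 1` layer of `NestingStatisticsAgree`
  (any centre, any window) follows from ALL-WINDOW ONE-DISC TILT AGREEMENT (the lead's candidate
  replacement of the `TowerStatisticsAgree` antecedent): peel the single count
  (`tendsto_cylinder_of_tendsto_tilt`, `m = 1`) if `B̄(z₀, r₀) ⊆ B(0, R)`, else the count is `0`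
  identically (`patternCount_eq_zero_of_le`).
* §4 statement audit (configuration level): the unit circles about `2 ∓ 1/4` have the same
  `2`-centred tower counts for ALL inner radii and windows but one-disc pattern counts `1 ≠ 0` for the
  disc `B̄(2, 1/2)` in the window `B(0, 3)` (`towerCount_blind_to_offCentre_window`): the off-centre
  one-disc layer is not an event of the disc-centred tower counts that `TowerStatisticsAgree` controls.
-/

noncomputable section

open MeasureTheory Set Filter Metric
open scoped Real Topology BigOperators

namespace Summit.CriticalPhenomena.CardyFormulaZ2.Cruxes.NestingRigidity.RingCloudTomography

open Literature.Probability.RandomPlanarGeometry Literature.Probability.Percolation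
  Literature.Probability.LatticeModels
open Summit.CriticalPhenomena.CardyFormulaZ2.Cruxes.NestingRigidity.PositiveConeWeightDoubling

/-! ## §1 Pure-logic glue: tilt agreement + PGF uniqueness ⇒ `Fusion` -/

/-- Tilt agreement at every admissible disc configuration and PGF uniqueness give
`NestingStatisticsAgree` outright (the cylinder probability `cyl` of `LawAgreementAt` is literally the
probability compared in `NestingStatisticsAgree`). -/
theorem nestingStatisticsAgree_of_tiltAgreement
    (hT : ∀ (n : ℕ) (z : Fin n → ℂ) (r : Fin n → ℝ) (R : ℝ), (∀ i, 0 < r i) →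
      (∀ i j, i ≠ j → r i + r j < ‖z i - z j‖) → TiltAgreementAt n z r R) (hP : PGFUniqueness) :
    NestingStatisticsAgree :=
  fun n z r R k hr hsep ↦ hP n z r R (hT n z r R hr hsep) k

/-- **Glue (registered sub-goal)**: positive tilt agreement at every admissible disc configuration
and PGF uniqueness imply `Fusion` — its cloud-law and `TowerStatisticsAgree` antecedents are unused. -/
theorem fusion_of_tiltAgreement :
    (∀ (n : ℕ) (z : Fin n → ℂ) (r : Fin n → ℝ) (R : ℝ), (∀ i, 0 < r i) →
      (∀ i j, i ≠ j → r i + r j < ‖z i - z j‖) → TiltAgreementAt n z r R) → PGFUniqueness → Fusion :=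
  fun hT hP _ _ _ ↦ nestingStatisticsAgree_of_tiltAgreement hT hP

/-- The same with `PGFUniqueness` discharged by the sibling line's landed `stub_pgfUniqueness`: ALL of
`Fusion` reduces to positive tilt agreement at every admissible disc configuration. -/
theorem fusion_of_tiltAgreement'
    (hT : ∀ (n : ℕ) (z : Fin n → ℂ) (r : Fin n → ℝ) (R : ℝ), (∀ i, 0 < r i) →
      (∀ i j, i ≠ j → r i + r j < ‖z i - z j‖) → TiltAgreementAt n z r R) : Fusion :=
  fusion_of_tiltAgreement hT stub_pgfUniqueness

/-! ## §2 One disc: the pattern count is an off-centre tower count; sandwich -/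

/-- For one disc `B̄(z₀, r₀)` and `S = {0}` the avoidance clause of `patternCount` is vacuous: the
pattern count is the number of loops in the window `B(0, R)` surrounding the disc. -/
theorem patternCount_one_eq (c : LoopConfig ℂ) (z₀ : ℂ) (r₀ R : ℝ) :
    patternCount c ![z₀] ![r₀] R {0} =
      {u ∈ c.loops | closedBall z₀ r₀ ⊆ {w | u.wind w ≠ 0} ∧ u.range ⊆ ball (0 : ℂ) R}.ncard := by
  unfold patternCount
  congr 1
  ext u
  simp only [mem_setOf_eq, Finset.mem_singleton, forall_eq, Matrix.cons_val_fin_one,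
    Fin.forall_fin_one, Fin.isValue, not_true_eq_false, IsEmpty.forall_iff, and_true]
  tauto

/-- `B(z₀, R − ‖z₀‖) ⊆ B(0, R)`. -/
theorem ball_sub_norm_subset_ball (z₀ : ℂ) (R : ℝ) : ball z₀ (R - ‖z₀‖) ⊆ ball (0 : ℂ) R :=
  ball_subset_ball' (by rw [dist_zero_right]; linarith)

/-- `B(0, R) ⊆ B(z₀, R + ‖z₀‖)`. -/
theorem ball_subset_ball_add_norm (z₀ : ℂ) (R : ℝ) : ball (0 : ℂ) R ⊆ ball z₀ (R + ‖z₀‖) :=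
  ball_subset_ball' (by rw [dist_zero_left])

/-- **Lower sandwich**: loops of the tower above `z₀` in the window `B(z₀, R − ‖z₀‖) ⊆ B(0, R)` are
counted by the one-disc pattern count (finiteness of the larger family is needed for `ncard`). -/
theorem towerCount_le_patternCount_one (c : LoopConfig ℂ) (z₀ : ℂ) (r₀ R : ℝ)
    (hfin : {u ∈ c.loops | closedBall z₀ r₀ ⊆ {w | u.wind w ≠ 0} ∧
      u.range ⊆ ball (0 : ℂ) R}.Finite) :
    towerCount c z₀ r₀ (R - ‖z₀‖) ≤ patternCount c ![z₀] ![r₀] R {0} := by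
  rw [patternCount_one_eq]
  exact Set.ncard_le_ncard
    (fun u hu ↦ ⟨hu.1, hu.2.1, hu.2.2.trans (ball_sub_norm_subset_ball z₀ R)⟩) hfin

/-- **Upper sandwich**: loops counted by the one-disc pattern count belong to the tower above `z₀` in
the window `B(z₀, R + ‖z₀‖) ⊇ B(0, R)`. -/
theorem patternCount_one_le_towerCount (c : LoopConfig ℂ) (z₀ : ℂ) (r₀ R : ℝ)
    (hfin : {u ∈ c.loops | closedBall z₀ r₀ ⊆ {w | u.wind w ≠ 0} ∧
      u.range ⊆ ball z₀ (R + ‖z₀‖)}.Finite) :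
    patternCount c ![z₀] ![r₀] R {0} ≤ towerCount c z₀ r₀ (R + ‖z₀‖) := by
  rw [patternCount_one_eq]
  exact Set.ncard_le_ncard
    (fun u hu ↦ ⟨hu.1, hu.2.1, hu.2.2.trans (ball_subset_ball_add_norm z₀ R)⟩) hfin

/-- On both lattice ensembles, at positive mesh, only finitely many loops have their trace in a
given ball. -/
theorem finite_loops_range_subset_ball : ∀ E ∈ latticeEnsembles, ∀ {δ : ℝ}, 0 < δ →
    ∀ (ω : E.Ω) (x : ℂ) (R : ℝ), {u ∈ (E.X δ ω).loops | u.range ⊆ ball x R}.Finite := by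
  intro E hE δ hδ ω x R
  have key : ∀ (c : LoopConfig ℂ),
      {u ∈ c.loops | (u.range ∩ closedBall (0 : ℂ) (R + ‖x‖)).Nonempty}.Finite →
        {u ∈ c.loops | u.range ⊆ ball x R}.Finite := by
    intro c hfin
    refine hfin.subset fun u hu ↦ ⟨hu.1, ?_⟩
    obtain ⟨p, hp⟩ := u.range_nonempty
    refine ⟨p, hp, ball_subset_closedBall ?_⟩
    exact (ball_subset_ball' (by rw [dist_zero_right]) : ball x R ⊆ ball (0 : ℂ) (R + ‖x‖))
      (hu.2 hp)
  simp only [latticeEnsembles, Set.mem_insert_iff, Set.mem_singleton_iff] at hE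
  rcases hE with rfl | rfl
  · exact key _ (ncard_loops_meeting_le hδ (R + ‖x‖) ω).1
  · exact key _ (ncard_loops_siteLoopConfig_meeting_le hδ (R + ‖x‖) ω).1

/-- **Sandwich on the lattice ensembles** (positive mesh, every configuration):
`N_{z₀}(r₀, R − ‖z₀‖) ≤ patternCount · ![z₀] ![r₀] R {0} ≤ N_{z₀}(r₀, R + ‖z₀‖)`. -/
theorem towerCount_le_patternCount_one_le : ∀ E ∈ latticeEnsembles, ∀ {δ : ℝ}, 0 < δ →
    ∀ (ω : E.Ω) (z₀ : ℂ) (r₀ R : ℝ),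
      towerCount (E.X δ ω) z₀ r₀ (R - ‖z₀‖) ≤ patternCount (E.X δ ω) ![z₀] ![r₀] R {0} ∧
        patternCount (E.X δ ω) ![z₀] ![r₀] R {0} ≤ towerCount (E.X δ ω) z₀ r₀ (R + ‖z₀‖) := by
  intro E hE δ hδ ω z₀ r₀ R
  exact ⟨towerCount_le_patternCount_one _ z₀ r₀ R
      ((finite_loops_range_subset_ball E hE hδ ω 0 R).subset fun u hu ↦ ⟨hu.1, hu.2.2⟩),
    patternCount_one_le_towerCount _ z₀ r₀ R
      ((finite_loops_range_subset_ball E hE hδ ω z₀ (R + ‖z₀‖)).subset fun u hu ↦ ⟨hu.1, hu.2.2⟩)⟩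


/-! ## §3 The one-disc layer of `NestingStatisticsAgree` from all-window one-disc tilt agreement -/

/-- `Finset.univ : Finset (Fin 1)` is the singleton `{0}`. -/
theorem finset_univ_fin_one : (Finset.univ : Finset (Fin 1)) = {0} := by
  ext i
  simp [Fin.fin_one_eq_zero i]

/-- The cylinder event of a single pattern count is measurable on both lattice ensembles. -/
theorem measurableSet_patternCount_cylinder :
    ∀ E ∈ latticeEnsembles, ∀ (δ : ℝ) {n : ℕ} (z : Fin n → ℂ) (r : Fin n → ℝ) (R : ℝ)
      (S : Finset (Fin n)) (k : ℕ),
      MeasurableSet {ω | ∀ _j : Fin 1, patternCount (E.X δ ω) z r R S = k} := by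
  intro E hE δ n z r R S k
  rw [Set.setOf_forall]
  exact MeasurableSet.iInter fun _ ↦
    measurable_patternCount E hE δ z r R S (measurableSet_singleton k)

/-- For one disc, the pattern event `∀ S ≠ ∅, N_S = k S` of `NestingStatisticsAgree` is the
single-count cylinder `N_{{0}} = k univ`, with the disc data in `![·]` form. -/
theorem setOf_pattern_one (E : LoopEnsemble) (δ : ℝ) (z : Fin 1 → ℂ) (r : Fin 1 → ℝ) (R : ℝ)
    (k : Finset (Fin 1) → ℕ) :
    {ω | ∀ S : Finset (Fin 1), S.Nonempty → patternCount (E.X δ ω) z r R S = k S} =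
      {ω | ∀ _j : Fin 1, patternCount (E.X δ ω) ![z 0] ![r 0] R {0} = k Finset.univ} := by
  have hz : ![z 0] = z := funext fun i ↦ by rw [Matrix.cons_val_fin_one, Fin.fin_one_eq_zero i]
  have hr : ![r 0] = r := funext fun i ↦ by rw [Matrix.cons_val_fin_one, Fin.fin_one_eq_zero i]
  ext ω
  simp only [mem_setOf_eq, forall_const, hz, hr, ← finset_univ_fin_one]
  constructor
  · exact fun h ↦ h Finset.univ ⟨0, Finset.mem_univ _⟩
  · intro h S hS
    rw [finset_fin_one_eq_univ hS]
    exact h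

/-- **The whole one-disc layer (`n = 1`, any centre, any window) of `NestingStatisticsAgree` follows
from ALL-WINDOW ONE-DISC TILT AGREEMENT** — asymptotic agreement of the tilted one-disc pattern
moments `E_δ[u^{N}]`, `N = patternCount · ![z₀] ![r₀] R {0}`, for every disc `B̄(z₀, r₀) ⊆ B(0, R)`
and every weight `u ∈ (0,1)` (the candidate replacement waypoint of the lead's reshape of S5): if the
disc lies in the window, peel the single count (`tendsto_cylinder_of_tendsto_tilt`, `m = 1`, trivial
weights); otherwise the count vanishes identically on both lattices (`patternCount_eq_zero_of_le`). The
pairwise-separation hypothesis of `NestingStatisticsAgree` is vacuous for `n = 1` and not needed. -/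
theorem nestingStatisticsAgree_one_of_oneDiscTilt
    (h : ∀ (z₀ : ℂ) (r₀ R u : ℝ), 0 < r₀ → closedBall z₀ r₀ ⊆ ball 0 R → 0 < u → u < 1 →
      Tendsto (fun δ : ℝ ↦ (∫ ω, u ^ patternCount (zEns.X δ ω) ![z₀] ![r₀] R {0} ∂zEns.P) -
        ∫ ω, u ^ patternCount (tEns.X δ ω) ![z₀] ![r₀] R {0} ∂tEns.P) (𝓝[>] 0) (𝓝 0))
    (z : Fin 1 → ℂ) (r : Fin 1 → ℝ) (R : ℝ) (k : Finset (Fin 1) → ℕ) (hr : ∀ i, 0 < r i) :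
    Tendsto (fun δ : ℝ ↦
      (zEns.P {ω | ∀ S : Finset (Fin 1), S.Nonempty →
          patternCount (zEns.X δ ω) z r R S = k S}).toReal -
        (tEns.P {ω | ∀ S : Finset (Fin 1), S.Nonempty →
          patternCount (tEns.X δ ω) z r R S = k S}).toReal) (𝓝[>] 0) (𝓝 0) := by
  haveI : IsProbabilityMeasure zEns.P := isProbabilityMeasure_of_mem zEns_mem
  haveI : IsProbabilityMeasure tEns.P := isProbabilityMeasure_of_mem tEns_mem
  simp only [setOf_pattern_one]
  rcases lt_or_ge (‖z 0‖ + r 0) R with hR | hR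
  · -- the disc lies in the window: peel the single count
    have hsub : closedBall (z 0) (r 0) ⊆ ball 0 R :=
      closedBall_subset_ball' (by rw [dist_zero_right]; linarith)
    have key := tendsto_cylinder_of_tendsto_tilt (l := 𝓝[>] (0 : ℝ)) (P := zEns.P) (P' := tEns.P)
      1 (W := fun _ _ ↦ (1 : ℝ)) (W' := fun _ _ ↦ (1 : ℝ))
      (N := fun δ ω _ ↦ patternCount (zEns.X δ ω) ![z 0] ![r 0] R {0})
      (N' := fun δ ω _ ↦ patternCount (tEns.X δ ω) ![z 0] ![r 0] R {0})
      (fun _ ↦ measurable_const) (fun _ ↦ measurable_const) (fun _ _ ↦ by simp) (fun _ _ ↦ by simp)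
      (fun δ _ ↦ measurable_patternCount zEns zEns_mem δ ![z 0] ![r 0] R {0})
      (fun δ _ ↦ measurable_patternCount tEns tEns_mem δ ![z 0] ![r 0] R {0})
      (fun u hu ↦ by
        simpa only [one_mul, Fin.prod_univ_one] using
          h (z 0) (r 0) R (u 0) (hr 0) hsub (hu 0).1 (hu 0).2)
      (fun _ ↦ k Finset.univ)
    simp only [one_mul] at key
    refine key.congr fun δ ↦ ?_
    rw [integral_ite_eq_toReal_measure zEns.P
        (measurableSet_patternCount_cylinder zEns zEns_mem δ ![z 0] ![r 0] R {0} (k Finset.univ)),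
      integral_ite_eq_toReal_measure tEns.P
        (measurableSet_patternCount_cylinder tEns tEns_mem δ ![z 0] ![r 0] R {0} (k Finset.univ))]
  · -- the disc sticks out of the window: the count vanishes identically on both lattices
    have h0 : ∀ c : LoopConfig ℂ, patternCount c ![z 0] ![r 0] R {0} = 0 := fun c ↦
      patternCount_eq_zero_of_le c _ _ R (Finset.mem_singleton_self 0)
        (by simpa using (hr 0).le) (by simpa using hR)
    simp only [h0, forall_const]
    by_cases hk : 0 = k Finset.univ
    · simp only [hk, setOf_true, measure_univ, ENNReal.toReal_one, sub_self]
      exact tendsto_const_nhds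
    · simp only [hk, setOf_false, measure_empty, ENNReal.toReal_zero, sub_self]
      exact tendsto_const_nhds


/-! ## §4 Statement audit of S5: `z₀`-centred tower counts do not see the window of an off-centre disc

Configuration-level witness. The unit circles about `z₀ ∓ 1/4` have THE SAME tower counts centred
at `z₀` for every inner radius and window (`towerCount_unitCircle_eq_ite`: `1` iff
`ρ < 3/4 ∧ 5/4 < R'`), but for `z₀ = 2`, the disc `B̄(2, 1/2)` and the window `B(0, 3)` the first is
counted by the one-disc pattern count and the second is not (`patternCount_unitCircle_left/right`):
`{patternCount · ![z₀] ![r₀] R {0} = k}` is not an event of the `z₀`-centred tower counts, and the gap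
of the sandwich of §2 (`R − ‖z₀‖ < outradius about z₀ < R + ‖z₀‖`) is populated on both sides. -/

open Literature.Barriers.CriticalPhenomena.NestingBlind (windLoop windCurve_apply
  range_windLoop_subset_sphere wind_windLoop_of_dist_lt)

/-- The point `c + r` (parameter `0`) lies on the trace of the `n`-fold circle. -/
theorem add_mem_range_windLoop (c : ℂ) (r : ℝ) (n : ℕ) : c + r ∈ (windLoop c r n).range :=
  ⟨0, show Literature.Barriers.CriticalPhenomena.NestingBlind.windCurve c r n 0 = c + r by
    rw [windCurve_apply]; simp⟩

/-- The point `c − r` (parameter `1/2`) lies on the trace of the simple circle. -/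
theorem sub_mem_range_windLoop (c : ℂ) (r : ℝ) : c - r ∈ (windLoop c r 1).range := by
  refine ⟨⟨1 / 2, by norm_num, by norm_num⟩, ?_⟩
  show Literature.Barriers.CriticalPhenomena.NestingBlind.windCurve c r 1 _ = c - r
  rw [windCurve_apply]
  have : (2 * π * Complex.I * ((1 : ℕ) : ℂ) * (((1 / 2 : ℝ)) : ℂ)) = π * Complex.I := by
    push_cast; ring
  simp only [this, Complex.exp_pi_mul_I]
  ring

/-- Norm of a real number seen in `ℂ`. -/
theorem norm_realCast (x : ℝ) : ‖(x : ℂ)‖ = |x| := by rw [Complex.norm_real, Real.norm_eq_abs]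

/-- **Inner condition.** For `ε = ±1/4`, the closed disc `B̄(z₀, ρ)` lies in the winding interior of
the unit circle about `z₀ + ε` iff `ρ < 3/4` (for `ρ ≥ 3/4` the disc contains the trace point
`z₀ − 3ε = (z₀ + ε) ∓ 1`, where `W = 0`). -/
theorem closedBall_subset_wind_unitCircle_iff (z₀ : ℂ) {ε : ℝ} (hε : ε = 1 / 4 ∨ ε = -(1 / 4))
    (ρ : ℝ) : closedBall z₀ ρ ⊆ {w | (windLoop (z₀ + ε) 1 1).wind w ≠ 0} ↔ ρ < 3 / 4 := by
  have habs : |ε| = 1 / 4 := by rcases hε with rfl | rfl <;> norm_num [abs_of_pos]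
  constructor
  · intro h
    by_contra hρ
    rw [not_lt] at hρ
    -- the trace point `z₀ - 3ε` lies in the disc
    have hp : z₀ + ((-(3 * ε) : ℝ) : ℂ) ∈ closedBall z₀ ρ := by
      rw [mem_closedBall, dist_eq_norm, add_sub_cancel_left, norm_realCast, abs_neg, abs_mul,
        habs, abs_of_pos (by norm_num : (0 : ℝ) < 3)]
      linarith
    have hrange : z₀ + ((-(3 * ε) : ℝ) : ℂ) ∈ (windLoop (z₀ + ε) 1 1).range := by
      rcases hε with rfl | rfl
      · convert sub_mem_range_windLoop (z₀ + ((1 / 4 : ℝ) : ℂ)) 1 using 1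
        push_cast; ring
      · convert add_mem_range_windLoop (z₀ + ((-(1 / 4) : ℝ) : ℂ)) 1 1 using 1
        push_cast; ring
    exact h hp (unbasedLoop_wind_of_mem_range _ hrange)
  · intro hρ w hw
    rw [mem_closedBall] at hw
    have hd : dist z₀ (z₀ + ε) = 1 / 4 := by
      rw [dist_comm, dist_eq_norm, add_sub_cancel_left, norm_realCast, habs]
    have hdist : dist w (z₀ + ε) < 1 := by
      calc dist w (z₀ + ε) ≤ dist w z₀ + dist z₀ (z₀ + ε) := dist_triangle _ _ _
        _ = dist w z₀ + 1 / 4 := by rw [hd]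
        _ < 1 := by linarith
    rw [mem_setOf_eq, wind_windLoop_of_dist_lt _ one_pos 1 hdist]
    norm_num

/-- **Window condition.** For `ε = ±1/4`, the trace of the unit circle about `z₀ + ε` lies in the
window `B(z₀, R')` iff `5/4 < R'` (the trace point `z₀ + 5ε = (z₀ + ε) ± 1` is at distance `5/4`). -/
theorem range_unitCircle_subset_ball_iff (z₀ : ℂ) {ε : ℝ} (hε : ε = 1 / 4 ∨ ε = -(1 / 4))
    (R' : ℝ) : (windLoop (z₀ + ε) 1 1).range ⊆ ball z₀ R' ↔ 5 / 4 < R' := by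
  have habs : |ε| = 1 / 4 := by rcases hε with rfl | rfl <;> norm_num [abs_of_pos]
  constructor
  · intro h
    have hrange : z₀ + (((5 * ε) : ℝ) : ℂ) ∈ (windLoop (z₀ + ε) 1 1).range := by
      rcases hε with rfl | rfl
      · convert add_mem_range_windLoop (z₀ + ((1 / 4 : ℝ) : ℂ)) 1 1 using 1
        push_cast; ring
      · convert sub_mem_range_windLoop (z₀ + ((-(1 / 4) : ℝ) : ℂ)) 1 using 1
        push_cast; ring
    have := h hrange
    rw [mem_ball, dist_eq_norm, add_sub_cancel_left, norm_realCast, abs_mul, habs,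
      abs_of_pos (by norm_num : (0 : ℝ) < 5)] at this
    linarith
  · intro hR w hw
    have hs := range_windLoop_subset_sphere _ _ _ hw
    rw [mem_sphere, abs_one] at hs
    rw [mem_ball]
    calc dist w z₀ ≤ dist w (z₀ + ε) + dist (z₀ + ε) z₀ := dist_triangle _ _ _
      _ = 1 + 1 / 4 := by rw [hs, dist_eq_norm, add_sub_cancel_left, norm_realCast, habs]
      _ < R' := by linarith

/-- The number of elements of a singleton satisfying a predicate. -/
theorem ncard_sep_singleton {α : Type*} (a : α) (P : α → Prop) [Decidable (P a)] :
    {u ∈ ({a} : Set α) | P u}.ncard = if P a then 1 else 0 := by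
  by_cases h : P a
  · rw [if_pos h]
    convert Set.ncard_singleton a
    ext u
    simp only [mem_setOf_eq, mem_singleton_iff]
    exact ⟨fun hu ↦ hu.1, fun hu ↦ ⟨hu, hu ▸ h⟩⟩
  · rw [if_neg h]
    convert Set.ncard_empty α
    ext u
    simp only [mem_setOf_eq, mem_singleton_iff, mem_empty_iff_false, iff_false, not_and]
    exact fun hu ↦ hu ▸ h

/-- **Tower blindness.** Every configuration whose only loop is the unit circle about `z₀ + ε`,
`ε = ±1/4`, has `z₀`-centred tower counts `N_{z₀}(ρ, R') = 1{ρ < 3/4 ∧ 5/4 < R'}` — the same for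
`ε = 1/4` and `ε = −1/4`, for every `ρ` and `R'`. -/
theorem towerCount_unitCircle_eq_ite (c : LoopConfig ℂ) (z₀ : ℂ) {ε : ℝ}
    (hε : ε = 1 / 4 ∨ ε = -(1 / 4)) (hc : c.loops = {windLoop (z₀ + ε) 1 1}) (ρ R' : ℝ) :
    towerCount c z₀ ρ R' = if ρ < 3 / 4 ∧ 5 / 4 < R' then 1 else 0 := by
  classical
  unfold towerCount
  rw [hc, ncard_sep_singleton, closedBall_subset_wind_unitCircle_iff z₀ hε,
    range_unitCircle_subset_ball_iff z₀ hε]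

/-- **… but the window `B(0, 3)` sees the difference (left circle).** With `z₀ = 2`, the unit circle
about `7/4` surrounds `B̄(2, 1/2)` inside `B(0, 3)`: pattern count `1`. -/
theorem patternCount_unitCircle_left (c : LoopConfig ℂ)
    (hc : c.loops = {windLoop ((2 : ℂ) + ((-(1 / 4) : ℝ) : ℂ)) 1 1}) :
    patternCount c ![(2 : ℂ)] ![1 / 2] 3 {0} = 1 := by
  classical
  rw [patternCount_one_eq, hc, ncard_sep_singleton, if_pos]
  refine ⟨(closedBall_subset_wind_unitCircle_iff 2 (Or.inr rfl) (1 / 2)).2 (by norm_num), ?_⟩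
  intro w hw
  have hs := range_windLoop_subset_sphere _ _ _ hw
  rw [mem_sphere, abs_one] at hs
  rw [mem_ball_zero_iff]
  calc ‖w‖ = ‖(w - ((2 : ℂ) + ((-(1 / 4) : ℝ) : ℂ))) + ((2 : ℂ) + ((-(1 / 4) : ℝ) : ℂ))‖ := by
        rw [sub_add_cancel]
    _ ≤ ‖w - ((2 : ℂ) + ((-(1 / 4) : ℝ) : ℂ))‖ + ‖(2 : ℂ) + ((-(1 / 4) : ℝ) : ℂ)‖ := norm_add_le _ _
    _ = 1 + 7 / 4 := by
        rw [← dist_eq_norm, hs, show (2 : ℂ) + ((-(1 / 4) : ℝ) : ℂ) = ((7 / 4 : ℝ) : ℂ) by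
          push_cast; norm_num, norm_realCast, abs_of_pos (by norm_num)]
    _ < 3 := by norm_num

/-- **… (right circle).** With `z₀ = 2`, the unit circle about `9/4` surrounds `B̄(2, 1/2)` but
passes through `13/4 ∉ B(0, 3)`: pattern count `0`. -/
theorem patternCount_unitCircle_right (c : LoopConfig ℂ)
    (hc : c.loops = {windLoop ((2 : ℂ) + ((1 / 4 : ℝ) : ℂ)) 1 1}) :
    patternCount c ![(2 : ℂ)] ![1 / 2] 3 {0} = 0 := by
  classical
  rw [patternCount_one_eq, hc, ncard_sep_singleton, if_neg]
  rintro ⟨-, h⟩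
  have hq := h (add_mem_range_windLoop ((2 : ℂ) + ((1 / 4 : ℝ) : ℂ)) 1 1)
  rw [mem_ball_zero_iff, show (2 : ℂ) + ((1 / 4 : ℝ) : ℂ) + ((1 : ℝ) : ℂ) = ((13 / 4 : ℝ) : ℂ) by
    push_cast; norm_num, norm_realCast, abs_of_pos (by norm_num)] at hq
  norm_num at hq

/-- **The witness, assembled**: two configurations with identical `z₀`-centred tower counts for all
inner radii and windows, and different one-disc pattern counts in the window `B(0, 3)`. -/
theorem towerCount_blind_to_offCentre_window (c c' : LoopConfig ℂ)
    (hc : c.loops = {windLoop ((2 : ℂ) + ((-(1 / 4) : ℝ) : ℂ)) 1 1})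
    (hc' : c'.loops = {windLoop ((2 : ℂ) + ((1 / 4 : ℝ) : ℂ)) 1 1}) :
    (∀ ρ R' : ℝ, towerCount c 2 ρ R' = towerCount c' 2 ρ R') ∧
      patternCount c ![(2 : ℂ)] ![1 / 2] 3 {0} ≠ patternCount c' ![(2 : ℂ)] ![1 / 2] 3 {0} := by
  refine ⟨fun ρ R' ↦ ?_, ?_⟩
  · rw [towerCount_unitCircle_eq_ite c 2 (Or.inr rfl) hc,
      towerCount_unitCircle_eq_ite c' 2 (Or.inl rfl) hc']
  · rw [patternCount_unitCircle_left c hc, patternCount_unitCircle_right c' hc']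
    exact one_ne_zero

end Summit.CriticalPhenomena.CardyFormulaZ2.Cruxes.NestingRigidity.RingCloudTomography

end
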